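import Literature.MathematicalPhysics.KineticTheory.HardSphereEuler

/-!
# Macroscopic bookkeeping for the hydrodynamic-limit assembly — III: no exactly cold blocks

Helper file for item stmt-AtomisticToContinuum-11094 (`StiffCollisionalRelaxation.Assembly`).
Deterministic half of the strict chamber condition `‖m̄‖² < 2 ρ̄ Ē` required of the comparison
field in `RelEntropyStability`:

* `two_mul_density_mul_energy_sub_norm_sq` — the Lagrange identity for the block fields of a
  configuration `z` tested against any `χ`:
  `2 ρ̄ Ē − ‖m̄‖² = ½ N⁻² ∑ᵢ ∑ⱼ χ(qᵢ) χ(qⱼ) ‖vᵢ − vⱼ‖²`;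
* `norm_sq_momentum_le` — the (weak) Cauchy–Schwarz inequality `‖m̄‖² ≤ 2 ρ̄ Ē` for `χ ≥ 0`;
* `norm_sq_momentum_lt` — STRICT inequality as soon as two distinct particles carry positive
  weight and have different velocities;
* `exists_two_weighted` — if `0 ≤ χ ≤ C` and the block density exceeds what one particle can
  carry, `N⁻¹ C < ρ̄`, then two distinct particles carry positive weight;
* `norm_sq_momentum_lt_of_density` — hence, for configurations with pairwise distinct velocities
  (almost sure at all times, part II) and blocks above the one-particle threshold (the a-priori
  density floor `c₁ ≤ ρ̄` with `φ_N ≤ C (N+1)^{3γ}`, `3γ < 1`), every block is strictly inside the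
  chamber.
-/

namespace Summit.AtomisticToContinuum.HydrodynamicLimit.Theorems.MacroBookkeeping

open MeasureTheory Finset
open Literature.MathematicalPhysics.KineticTheory
open Literature.Analysis.FluidPDE (Config empiricalMeasure integral_empiricalMeasure)
open scoped RealInnerProductSpace

noncomputable section

variable {N : ℕ}

/-- The empirical average of a vector-valued observable (local copy of the part-I lemma, to keep
this file independent). -/
private theorem integral_empiricalMeasure_vec {F : Type*} [NormedAddCommGroup F]
    [NormedSpace ℝ F] [CompleteSpace F] (z : Config N (Fin 3) T3) (f : T3 × V3 → F) :
    ∫ y, f y ∂empiricalMeasure z = (N : ℝ)⁻¹ • ∑ i, f (z i) := by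
  rw [Literature.Analysis.FluidPDE.empiricalMeasure_eq, integral_smul_measure,
    integral_finsetSum_measure fun i _ => integrable_dirac (by simp)]
  simp [integral_dirac, ENNReal.toReal_inv]

/-- The three block fields of `z` tested against `χ` as finite sums. -/
theorem blockFields_eq_sum (z : Config N (Fin 3) T3) (χ : T3 → ℝ) :
    empiricalDensityField z χ = (N : ℝ)⁻¹ * ∑ i, χ (z i).1 ∧
    empiricalMomentumField z χ = (N : ℝ)⁻¹ • ∑ i, χ (z i).1 • (z i).2 ∧
    empiricalEnergyField z χ = (N : ℝ)⁻¹ * ∑ i, χ (z i).1 * (‖(z i).2‖ ^ 2 / 2) :=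
  ⟨integral_empiricalMeasure z _, integral_empiricalMeasure_vec z _, integral_empiricalMeasure z _⟩

/-- **Lagrange's identity for weighted velocities**: for real weights `w` and vectors `v`,
`2 (∑ wᵢ)(∑ wᵢ‖vᵢ‖²/2) − ‖∑ wᵢ vᵢ‖² = ½ ∑ᵢ ∑ⱼ wᵢ wⱼ ‖vᵢ − vⱼ‖²`. -/
theorem lagrange_identity (w : Fin N → ℝ) (v : Fin N → V3) :
    2 * (∑ i, w i) * (∑ i, w i * (‖v i‖ ^ 2 / 2)) - ‖∑ i, w i • v i‖ ^ 2 =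
      2⁻¹ * ∑ i, ∑ j, w i * w j * ‖v i - v j‖ ^ 2 := by
  have hnorm : ‖∑ i, w i • v i‖ ^ 2 = ∑ i, ∑ j, w i * w j * ⟪v i, v j⟫ := by
    rw [← real_inner_self_eq_norm_sq, sum_inner]
    refine Finset.sum_congr rfl fun i _ => ?_
    rw [inner_sum]
    refine Finset.sum_congr rfl fun j _ => ?_
    rw [real_inner_smul_left, real_inner_smul_right, mul_assoc]
  have hterm : ∀ i j, w i * w j * ‖v i - v j‖ ^ 2 =
      w i * (w j * ‖v j‖ ^ 2) + w i * ‖v i‖ ^ 2 * w j - 2 * (w i * w j * ⟪v i, v j⟫) := by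
    intro i j
    rw [norm_sub_sq_real]
    ring
  have hrhs : ∑ i, ∑ j, w i * w j * ‖v i - v j‖ ^ 2 =
      (∑ i, w i) * (∑ j, w j * ‖v j‖ ^ 2) + (∑ i, w i * ‖v i‖ ^ 2) * (∑ j, w j) -
        2 * ∑ i, ∑ j, w i * w j * ⟪v i, v j⟫ := by
    simp only [hterm, Finset.sum_add_distrib, Finset.sum_sub_distrib, ← Finset.mul_sum,
      ← Finset.sum_mul]
  have hhalf : ∑ i, w i * (‖v i‖ ^ 2 / 2) = 2⁻¹ * ∑ i, w i * ‖v i‖ ^ 2 := by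
    rw [Finset.mul_sum]
    exact Finset.sum_congr rfl fun i _ => by ring
  rw [hnorm, hrhs, hhalf]
  ring

/-- **Lagrange identity for block fields**:
`2 ρ̄ Ē − ‖m̄‖² = ½ N⁻² ∑ᵢ ∑ⱼ χ(qᵢ) χ(qⱼ) ‖vᵢ − vⱼ‖²`. -/
theorem two_mul_density_mul_energy_sub_norm_sq (z : Config N (Fin 3) T3) (χ : T3 → ℝ) :
    2 * empiricalDensityField z χ * empiricalEnergyField z χ - ‖empiricalMomentumField z χ‖ ^ 2 =
      2⁻¹ * ((N : ℝ)⁻¹) ^ 2 *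
        ∑ i, ∑ j, χ (z i).1 * χ (z j).1 * ‖(z i).2 - (z j).2‖ ^ 2 := by
  obtain ⟨hρ, hm, hE⟩ := blockFields_eq_sum z χ
  have key := lagrange_identity (fun i => χ (z i).1) (fun i => (z i).2)
  rw [hρ, hm, hE, norm_smul, mul_pow, Real.norm_eq_abs, abs_of_nonneg (by positivity)]
  have hS : ‖∑ i, χ (z i).1 • (z i).2‖ ^ 2 =
      2 * (∑ i, χ (z i).1) * (∑ i, χ (z i).1 * (‖(z i).2‖ ^ 2 / 2)) -
        2⁻¹ * ∑ i, ∑ j, χ (z i).1 * χ (z j).1 * ‖(z i).2 - (z j).2‖ ^ 2 := by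
    linarith [key]
  rw [hS]
  ring

/-- **Cauchy–Schwarz for block fields** (weak form): `‖m̄‖² ≤ 2 ρ̄ Ē` for `χ ≥ 0`. -/
theorem norm_sq_momentum_le (z : Config N (Fin 3) T3) {χ : T3 → ℝ} (hχ : ∀ y, 0 ≤ χ y) :
    ‖empiricalMomentumField z χ‖ ^ 2 ≤ 2 * empiricalDensityField z χ * empiricalEnergyField z χ := by
  have h := two_mul_density_mul_energy_sub_norm_sq z χ
  have hnn : 0 ≤ 2⁻¹ * ((N : ℝ)⁻¹) ^ 2 *
      ∑ i, ∑ j, χ (z i).1 * χ (z j).1 * ‖(z i).2 - (z j).2‖ ^ 2 := by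
    refine mul_nonneg (by positivity) (Finset.sum_nonneg fun i _ => Finset.sum_nonneg fun j _ => ?_)
    exact mul_nonneg (mul_nonneg (hχ _) (hχ _)) (by positivity)
  linarith

/-- **Strict Cauchy–Schwarz**: if two distinct particles carry positive weight and have different
velocities, then `‖m̄‖² < 2 ρ̄ Ē`. -/
theorem norm_sq_momentum_lt (z : Config N (Fin 3) T3) {χ : T3 → ℝ} (hχ : ∀ y, 0 ≤ χ y)
    {i j : Fin N} (hi : 0 < χ (z i).1) (hj : 0 < χ (z j).1) (hv : (z i).2 ≠ (z j).2) :
    ‖empiricalMomentumField z χ‖ ^ 2 < 2 * empiricalDensityField z χ * empiricalEnergyField z χ := by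
  have h := two_mul_density_mul_energy_sub_norm_sq z χ
  have hN : N ≠ 0 := Fin.pos i |>.ne'
  have hterm : ∀ a b : Fin N, 0 ≤ χ (z a).1 * χ (z b).1 * ‖(z a).2 - (z b).2‖ ^ 2 := fun a b =>
    mul_nonneg (mul_nonneg (hχ _) (hχ _)) (by positivity)
  have hij : 0 < χ (z i).1 * χ (z j).1 * ‖(z i).2 - (z j).2‖ ^ 2 :=
    mul_pos (mul_pos hi hj) (by positivity [norm_pos_iff.2 (sub_ne_zero.2 hv)])
  have hsum : 0 < ∑ a, ∑ b, χ (z a).1 * χ (z b).1 * ‖(z a).2 - (z b).2‖ ^ 2 := by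
    calc (0 : ℝ) < χ (z i).1 * χ (z j).1 * ‖(z i).2 - (z j).2‖ ^ 2 := hij
      _ ≤ ∑ b, χ (z i).1 * χ (z b).1 * ‖(z i).2 - (z b).2‖ ^ 2 :=
          Finset.single_le_sum (fun b _ => hterm i b) (Finset.mem_univ j)
      _ ≤ ∑ a, ∑ b, χ (z a).1 * χ (z b).1 * ‖(z a).2 - (z b).2‖ ^ 2 :=
          Finset.single_le_sum (fun a _ => Finset.sum_nonneg fun b _ => hterm a b)
            (Finset.mem_univ i)
  have hpos : 0 < 2⁻¹ * ((N : ℝ)⁻¹) ^ 2 *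
      ∑ a, ∑ b, χ (z a).1 * χ (z b).1 * ‖(z a).2 - (z b).2‖ ^ 2 := by
    have hN' : (0 : ℝ) < (N : ℝ)⁻¹ := inv_pos.2 (by exact_mod_cast Nat.pos_of_ne_zero hN)
    positivity
  linarith

/-- **Counting**: if `0 ≤ χ ≤ C` and `N⁻¹ C < ρ̄`, two distinct particles carry positive weight
(one particle contributes at most `N⁻¹ C` to the block density). -/
theorem exists_two_weighted (z : Config N (Fin 3) T3) {χ : T3 → ℝ} {C : ℝ} (hχ : ∀ y, 0 ≤ χ y)
    (hχC : ∀ y, χ y ≤ C) (hρ : (N : ℝ)⁻¹ * C < empiricalDensityField z χ) :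
    ∃ i j : Fin N, i ≠ j ∧ 0 < χ (z i).1 ∧ 0 < χ (z j).1 := by
  by_contra hcon
  push Not at hcon
  have hρ' := (blockFields_eq_sum z χ).1
  -- every particle but possibly one has weight zero, so the sum is at most `C`
  have hsumle : ∑ i, χ (z i).1 ≤ C := by
    by_cases hex : ∃ i, 0 < χ (z i).1
    · obtain ⟨i, hi⟩ := hex
      have hothers : ∀ j, j ≠ i → χ (z j).1 = 0 := fun j hji =>
        le_antisymm (hcon i j hji.symm hi) (hχ _)
      rw [← Finset.add_sum_erase _ _ (Finset.mem_univ i),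
        Finset.sum_eq_zero fun j hj => hothers j (Finset.ne_of_mem_erase hj), add_zero]
      exact hχC _
    · push Not at hex
      have hC : 0 ≤ C := by
        by_cases hN : N = 0
        · subst hN
          simp [empiricalDensityField, Literature.Analysis.FluidPDE.integral_empiricalMeasure] at hρ
        · obtain ⟨k⟩ : Nonempty (Fin N) := Fin.pos_iff_nonempty.1 (Nat.pos_of_ne_zero hN)
          exact (hχ (z k).1).trans (hχC _)
      exact (Finset.sum_nonpos fun i _ => hex i).trans hC
  have : empiricalDensityField z χ ≤ (N : ℝ)⁻¹ * C := by
    rw [hρ']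
    exact mul_le_mul_of_nonneg_left hsumle (by positivity)
  linarith

/-- **No exactly cold block above the one-particle threshold**: for a configuration with pairwise
distinct velocities and a nonnegative test function `χ ≤ C` whose block density exceeds `N⁻¹ C`,
the strict chamber inequality `‖m̄‖² < 2 ρ̄ Ē` holds. -/
theorem norm_sq_momentum_lt_of_density (z : Config N (Fin 3) T3)
    (hvel : ∀ i j : Fin N, i ≠ j → (z i).2 ≠ (z j).2) {χ : T3 → ℝ} {C : ℝ} (hχ : ∀ y, 0 ≤ χ y)
    (hχC : ∀ y, χ y ≤ C) (hρ : (N : ℝ)⁻¹ * C < empiricalDensityField z χ) :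
    ‖empiricalMomentumField z χ‖ ^ 2 < 2 * empiricalDensityField z χ * empiricalEnergyField z χ := by
  obtain ⟨i, j, hij, hi, hj⟩ := exists_two_weighted z hχ hχC hρ
  exact norm_sq_momentum_lt z hχ hi hj (hvel i j hij)

end

end Summit.AtomisticToContinuum.HydrodynamicLimit.Theorems.MacroBookkeeping
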